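import Mathlib
import HarnessLib
import Summits.AtomisticToContinuum.FouriersLaw.Theses.JunctionLocality
import Summits.AtomisticToContinuum.FouriersLaw.Theorems.JunctionLocalitySuperadditiveResistanceStubInsertionIdentity
import Summits.AtomisticToContinuum.FouriersLaw.Theorems.JunctionLocalitySuperadditiveResistanceFarTransmissionHelpers
import Summits.AtomisticToContinuum.FouriersLaw.Theorems.JunctionLocalitySuperadditiveResistanceKuboFrame
import Summits.AtomisticToContinuum.FouriersLaw.Theorems.JunctionLocalitySuperadditiveResistanceStubLinearResponsePlain
import Summits.AtomisticToContinuum.FouriersLaw.Theorems.JunctionLocalitySuperadditiveResistanceTransferV4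

/-!
# Line `thermalise-then-cut-probe-insertion` — TRANSFER THEOREM of skeleton v4.1: the thermometer is not a bet (signs form)
(crux `JunctionLocality.SuperadditiveResistance`, stmt-AtomisticToContinuum-11748; lead prover-line-stmt-AtomisticToContinuum-11748-c1-0,
2026-08-16)

Skeleton v3 paid the α-leg of the line at the FLOATING probe temperature `θᶠ`, so its roughness bet
`v_K(h − θᶠe_K) ≤ C₂G_L²` contained a THERMOMETER component `|θᶠ − θ*| ≤ C G_L` (a floating γ-probe pair reads the plain
chain's local first-order kinetic temperature up to `O(current)`). This file removes it by pure real algebra: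

* `alpha_leg_twoEnded` — the flux functionals are affine in the common probe temperature, `𝒢₁(θ) = x + u(1/2 − θ)`,
  `𝒢₄(θ) = x + v(1/2 + θ)`, and agree at `θᶠ` (`= G_dev`), hence EXACTLY `(u+v)(G_dev − G_L) = v(𝒢₁(θ) − G_L) + u(𝒢₄(θ) − G_L)`
  for EVERY `θ`; so the two-sided insertion-identity bounds `|𝒢₁(θ) − G_L| ≤ K a G_L`, `|𝒢₄(θ) − G_L| ≤ K b G_L` at ANY ONE `θ`
  give `G_L − G_dev ≤ (2/(1−ρ))·K·min(a,b)·G_L` once `u, v ≥ 0` and `x ≥ −ρ·min(u,v)`, `ρ < 1` — v4.1: NO upper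
  bound on the bypass is needed, and PSD alone already gives `ρ = 1` (`a, b ≥ 0`), so the bet is only the signs of `u, v` and the
  margin `ρ < 1` (the degenerate corner `u+v = 0` included);
* `alpha_leg_twoEnded_signs` supersedes `TransferV4.alpha_leg_twoEnded` (hypothesis `|x| ≤ ρ min(u,v)` weakened to
  `x ≥ −ρ min(u,v)`);
* `insertion_bound_abs` — the two-sided Cauchy–Schwarz bookkeeping `|Δ| ≤ γ²√(C₂⁺C₃⁺)·s·G`;
* `superadditiveResistance_of_lineBetsV4signs` — with `stub_linearResponsePlain` now a THEOREM (p96604) and the landed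
  `insertionIdentity_of_kuboFrame` (p91006), the FIVE open registered stubs of skeleton v4
  (`Cruxes/SuperadditiveResistance/Lines/thermalise_then_cut_probe_insertion.lean`): `stub_kuboFrame` (fixed-`N`),
  `stub_junctionRoughnessLTE` (`∃ θ, v_K(h − θe_K) ≤ C₂G_L²`: roughness of the PLAIN chain's response field modulo a Gibbs shift of
  the pair — no device object, no thermometer), `stub_junctionCurvature`, `stub_transferSigns` (NEW sign bet `u, v ≥ 0`, `x ≥ −ρ·min(u,v)`, the price of
  mixing the two ends), `stub_terminationLocalityTC`, `stub_farTransmission` — taken as HYPOTHESES, spelled out verbatim (they are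
  conjectures of the line, not literature) — imply the crux BY NAME with `C = 4c + 4K′ + 4K′(1+c) + 2`,
  `K′ = (2/(1−ρ))γ²√(C₂⁺C₃⁺)`, `c = max(c_TL, c_FT, 0)`, through the unsigned real-analysis core
  `FarTransmission.core_estimate_unsigned` (p74848) and the Dirichlet principle `deviceConductance_le`.
No definitions, no named facts; standard axioms.
-/

noncomputable section

open MeasureTheory Filter Topology ProbabilityTheory
open scoped ContDiff NNReal
open Literature.MathematicalPhysics.KineticTheory.HeatConduction

namespace Summit.AtomisticToContinuum.FouriersLaw.Cruxes.SuperadditiveResistance.ThermaliseThenCutProbeInsertion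

namespace TransferV4Signs


open TransferV4 (insertion_bound_abs selfLeft_eq_transfer_add_bypass selfRight_eq_transfer_add_bypass)

/-- **TWO-ENDED ELIMINATION OF THE PROBE TEMPERATURE (pure real algebra; v4 — replaces the v3 thermometer).**
The flux functionals are affine in the common probe temperature, `𝒢₁(θ) = x + u(1/2 − θ)`, `𝒢₄(θ) = x + v(1/2 + θ)`,
and agree at the floating temperature, `𝒢₁(θᶠ) = 𝒢₄(θᶠ) = G_dev`; hence EXACTLY
`(u + v)(G_dev − G_L) = v(𝒢₁(θ) − G_L) + u(𝒢₄(θ) − G_L)` for EVERY `θ` (the floating weights kill the `θ`-terms).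
So the two-sided identity bounds `|𝒢₁(θ) − G_L| ≤ K a G_L`, `|𝒢₄(θ) − G_L| ≤ K b G_L` at ANY ONE `θ` give
`G_L − G_dev ≤ K G_L (va + ub)/(u+v) ≤ (2/(1−ρ)) K min(a,b) G_L` once `u, v ≥ 0` and `x ≥ −ρ min(u,v)`, `ρ < 1`
(`va + ub = 2uv + x(u+v)`, `2uv/(u+v) ≤ 2min(u,v)`, `min(a,b) = min(u,v) + x ≥ (1−ρ)min(u,v)`). Degenerate
`u + v = 0`: then `u = v = 0 ≤ x = a = b = G_dev` and the bath-1 bound is the claim. -/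
theorem alpha_leg_twoEnded_signs :
    ∀ {g : Fin 4 → Fin 4 → ℝ} {θ Gw K ρ : ℝ}, 0 ≤ Gw → 0 ≤ K → 0 ≤ ρ → ρ < 1 →
      0 ≤ transferLeft g → 0 ≤ transferRight g →
      -(ρ * min (transferLeft g) (transferRight g)) ≤ bypass g →
      |sideOne g θ - Gw| ≤ K * selfLeft g * Gw → |sideFour g θ - Gw| ≤ K * selfRight g * Gw →
      Gw - deviceConductance g ≤ 2 / (1 - ρ) * K * min (selfLeft g) (selfRight g) * Gw := by
  intro g θ Gw K ρ hGL hK hρ0 hρ1 hu0 hv0 hdom h1 h4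
  have ha : selfLeft g = transferLeft g + bypass g := selfLeft_eq_transfer_add_bypass g
  have hb : selfRight g = transferRight g + bypass g := selfRight_eq_transfer_add_bypass g
  have e1 : sideOne g θ = bypass g + transferLeft g * (1 / 2 - θ) := rfl
  have e4 : sideFour g θ = bypass g + transferRight g * (1 / 2 + θ) := rfl
  have hρ1' : 0 < 1 - ρ := by linarith
  have hcoef : 0 ≤ 2 / (1 - ρ) * K := by positivity
  -- generalize the three transfer data
  rw [ha, hb]
  rw [ha] at h1
  rw [hb] at h4
  rw [e1] at h1
  rw [e4] at h4
  have hGd : deviceConductance g = bypass g + transferLeft g * (1 / 2 - floatTemp g) := rfl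
  have hfl : floatTemp g = (transferLeft g - transferRight g) / (2 * (transferLeft g + transferRight g)) := rfl
  rw [hGd, hfl]
  generalize transferLeft g = u at *
  generalize transferRight g = v at *
  generalize bypass g = x at *
  -- elementary consequences of the ratio bet
  have hmin0 : 0 ≤ min u v := le_min hu0 hv0
  have hxlo : -(ρ * min u v) ≤ x := hdom
  have hm : min (u + x) (v + x) = min u v + x := min_add_add_right u v x
  have hm_lo : (1 - ρ) * min u v ≤ min u v + x := by nlinarith only [hxlo]
  have hm0 : 0 ≤ min u v + x := le_trans (by positivity) hm_lo
  rw [hm]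
  rcases (add_nonneg hu0 hv0).eq_or_lt with h0 | hpos
  · -- degenerate: u = v = 0, hence x ≥ 0, a = b = x = G_dev, and the bath-1 bound is the claim
    have hu : u = 0 := by linarith [le_antisymm (by linarith : u ≤ 0) hu0]
    have hv : v = 0 := by linarith
    subst hu; subst hv
    have hx0 : 0 ≤ x := by simpa using hdom
    have h1' : Gw - x ≤ K * x * Gw := by
      have : |x + 0 * (1 / 2 - θ) - Gw| ≤ K * (0 + x) * Gw := h1
      simp only [zero_mul, add_zero, zero_add] at this
      linarith [neg_abs_le (x - Gw), abs_sub_comm x Gw, le_abs_self (Gw - x)]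
    have hKx : 0 ≤ K * x * Gw := by positivity
    have hcoef1 : 1 ≤ 2 / (1 - ρ) := by rw [le_div_iff₀ hρ1']; linarith
    simp only [min_self, zero_add, zero_mul, sub_zero, add_zero, zero_div, mul_zero]
    nlinarith only [h1', hKx, hcoef1]
  · -- main case
    have hne : u + v ≠ 0 := ne_of_gt hpos
    -- (u+v) G_dev = (u+v) x + u v
    have hGd' : (u + v) * (x + u * (1 / 2 - (u - v) / (2 * (u + v)))) = (u + v) * x + u * v := by
      field_simp
      ring
    -- exact elimination: (u+v)(Gw − G_dev) = −(v E₁ + u E₄)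
    have helim : (u + v) * (Gw - (x + u * (1 / 2 - (u - v) / (2 * (u + v))))) =
        -(v * (x + u * (1 / 2 - θ) - Gw) + u * (x + v * (1 / 2 + θ) - Gw)) := by
      have : (u + v) * (Gw - (x + u * (1 / 2 - (u - v) / (2 * (u + v))))) =
          (u + v) * Gw - ((u + v) * x + u * v) := by rw [← hGd']; ring
      rw [this]; ring
    -- two-sided bounds
    have hE1' : -(x + u * (1 / 2 - θ) - Gw) ≤ K * (u + x) * Gw :=
      le_trans (neg_le_abs _) h1
    have hE4' : -(x + v * (1 / 2 + θ) - Gw) ≤ K * (v + x) * Gw :=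
      le_trans (neg_le_abs _) h4
    have hE1 := mul_le_mul_of_nonneg_left hE1' hv0
    have hE4 := mul_le_mul_of_nonneg_left hE4' hu0
    have hsum : (u + v) * (Gw - (x + u * (1 / 2 - (u - v) / (2 * (u + v))))) ≤
        K * Gw * (2 * (u * v) + x * (u + v)) := by
      rw [helim]
      have e : v * (K * (u + x) * Gw) + u * (K * (v + x) * Gw) = K * Gw * (2 * (u * v) + x * (u + v)) := by
        ring
      have e1 : v * -(x + u * (1 / 2 - θ) - Gw) = -(v * (x + u * (1 / 2 - θ) - Gw)) := by ring
      have e4 : u * -(x + v * (1 / 2 + θ) - Gw) = -(u * (x + v * (1 / 2 + θ) - Gw)) := by ring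
      linarith only [hE1, hE4, e, e1, e4]
    -- 2uv ≤ 2 min(u,v) (u+v) and 2 min + x ≤ (2/(1−ρ)) (min + x)
    have huv : 2 * (u * v) ≤ 2 * min u v * (u + v) := by
      rcases le_total u v with huv | hvu
      · rw [min_eq_left huv]; nlinarith only [mul_nonneg hu0 hu0, huv, hu0]
      · rw [min_eq_right hvu]; nlinarith only [mul_nonneg hv0 hv0, hvu, hv0]
    have h2 : 2 * min u v + x ≤ 2 / (1 - ρ) * (min u v + x) := by
      rw [div_mul_eq_mul_div, le_div_iff₀ hρ1']
      have hx1 := mul_le_mul_of_nonneg_left hxlo (by linarith : (0 : ℝ) ≤ 1 + ρ)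
      have hnn : 0 ≤ ρ * (1 - ρ) * min u v := mul_nonneg (mul_nonneg hρ0 hρ1'.le) hmin0
      nlinarith only [hx1, hnn]
    have h3 := mul_le_mul_of_nonneg_left h2 hpos.le
    have hkey : 2 * (u * v) + x * (u + v) ≤ (u + v) * (2 / (1 - ρ) * (min u v + x)) := by
      have e : (u + v) * (2 * min u v + x) = 2 * min u v * (u + v) + x * (u + v) := by ring
      linarith only [huv, h3, e]
    have hfin : (u + v) * (Gw - (x + u * (1 / 2 - (u - v) / (2 * (u + v))))) ≤
        (u + v) * (2 / (1 - ρ) * K * (min u v + x) * Gw) := by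
      have hKGL : 0 ≤ K * Gw := mul_nonneg hK hGL
      have step := mul_le_mul_of_nonneg_left hkey hKGL
      have e : K * Gw * ((u + v) * (2 / (1 - ρ) * (min u v + x))) =
          (u + v) * (2 / (1 - ρ) * K * (min u v + x) * Gw) := by ring
      linarith only [hsum, step, e]
    exact le_of_mul_le_mul_left hfin hpos

/-- **TRANSFER THEOREM (skeleton v4.1).** The five open registered stubs of the line, as hypotheses, imply the crux
`JunctionLocality.SuperadditiveResistance` BY NAME (the sixth ingredient `stub_linearResponsePlain` is the landed theorem, p96604;
the insertion identity is the landed `insertionIdentity_of_kuboFrame`, p91006). Constant `C = 4c + 4K′ + 4K′(1+c) + 2`,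
`K′ = (2/(1−ρ))·γ²√(C₂⁺C₃⁺)`, `c = max(c_TL, c_FT, 0)`. -/
theorem superadditiveResistance_of_lineBetsV4signs :
    (∀ (ω₂ lam β γ T : ℝ), 0 < ω₂ → 0 < lam → 0 < β → 0 < γ → 0 < T →
        ∀ N M : ℕ, 2 ≤ N → 2 ≤ M →
          ∃ (g : Fin 4 → Fin 4 → ℝ) (gb₁ gb₄ : PhaseSpace (N + M) → ℝ),
            KuboFrame (pinnedChain ω₂ lam β γ) T N M g gb₁ gb₄) →
    (∀ (ω₂ lam β γ : ℝ) (μ : (N : ℕ) → ℝ → ℝ → Measure (PhaseSpace N)) (T : ℝ) (D : ℕ → ℝ),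
        CruxFrame ω₂ lam β γ μ T D →
        ∃ C₂ : ℝ, ∀ N M : ℕ, 2 ≤ N → 2 ≤ M →
          ∀ (h : PhaseSpace (N + M) → ℝ),
            PlainFrame (pinnedChain ω₂ lam β γ) T (N + M) h (D (N + M) / ((N : ℝ) + (M : ℝ) - 1)) →
            ∃ θ : ℝ, roughness (pinnedChain ω₂ lam β γ) T N M (fun x => h x - θ * eK T N M x) ≤
              C₂ * (D (N + M) / ((N : ℝ) + (M : ℝ) - 1)) ^ 2) →
    (∀ (ω₂ lam β γ T : ℝ), 0 < ω₂ → 0 < lam → 0 < β → 0 < γ → 0 < T →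
        ∃ C₃ : ℝ, ∀ N M : ℕ, 2 ≤ N → 2 ≤ M →
          ∀ (g : Fin 4 → Fin 4 → ℝ) (gb₁ gb₄ : PhaseSpace (N + M) → ℝ),
            KuboFrame (pinnedChain ω₂ lam β γ) T N M g gb₁ gb₄ →
            curvature (pinnedChain ω₂ lam β γ) T N M gb₁ ≤ C₃ * selfLeft g ^ 2 ∧
            curvature (pinnedChain ω₂ lam β γ) T N M gb₄ ≤ C₃ * selfRight g ^ 2) →
    (∀ (ω₂ lam β γ T : ℝ), 0 < ω₂ → 0 < lam → 0 < β → 0 < γ → 0 < T →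
        ∃ ρ : ℝ, 0 ≤ ρ ∧ ρ < 1 ∧ ∀ N M : ℕ, 2 ≤ N → 2 ≤ M →
          ∀ (g : Fin 4 → Fin 4 → ℝ) (gb₁ gb₄ : PhaseSpace (N + M) → ℝ),
            KuboFrame (pinnedChain ω₂ lam β γ) T N M g gb₁ gb₄ →
            0 ≤ transferLeft g ∧ 0 ≤ transferRight g ∧
              -(ρ * min (transferLeft g) (transferRight g)) ≤ bypass g) →
    (∀ (ω₂ lam β γ : ℝ) (μ : (N : ℕ) → ℝ → ℝ → Measure (PhaseSpace N)) (T : ℝ) (D : ℕ → ℝ),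
        CruxFrame ω₂ lam β γ μ T D →
        (∀ L : ℕ, 2 ≤ L → ∃ h : PhaseSpace L → ℝ,
            PlainFrame (pinnedChain ω₂ lam β γ) T L h (D L / ((L : ℝ) - 1))) →
        ∃ c : ℝ, ∀ N M : ℕ, 2 ≤ N → 2 ≤ M →
          ∀ (g : Fin 4 → Fin 4 → ℝ) (gb₁ gb₄ : PhaseSpace (N + M) → ℝ),
            KuboFrame (pinnedChain ω₂ lam β γ) T N M g gb₁ gb₄ →
            selfLeft g ≤ D N / ((N : ℝ) - 1) * (1 + c * (D N / ((N : ℝ) - 1))) ∧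
            selfRight g ≤ D M / ((M : ℝ) - 1) * (1 + c * (D M / ((M : ℝ) - 1)))) →
    (∀ (ω₂ lam β γ : ℝ) (μ : (N : ℕ) → ℝ → ℝ → Measure (PhaseSpace N)) (T : ℝ) (D : ℕ → ℝ),
        CruxFrame ω₂ lam β γ μ T D →
        (∀ L : ℕ, 2 ≤ L → ∃ h : PhaseSpace L → ℝ,
            PlainFrame (pinnedChain ω₂ lam β γ) T L h (D L / ((L : ℝ) - 1))) →
        ∃ c : ℝ, ∀ N M : ℕ, 2 ≤ N → 2 ≤ M →
          ∀ (g : Fin 4 → Fin 4 → ℝ) (gb₁ gb₄ : PhaseSpace (N + M) → ℝ),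
            KuboFrame (pinnedChain ω₂ lam β γ) T N M g gb₁ gb₄ →
            bypass g ≤ c * (D N / ((N : ℝ) - 1)) * (D M / ((M : ℝ) - 1))) →
    Summit.AtomisticToContinuum.FouriersLaw.Theses.JunctionLocality.SuperadditiveResistance := by
  intro hLRd hRO hCU hBD hTL hFT
  have hLRp := stub_linearResponsePlain
  have hID := insertionIdentity_of_kuboFrame
  intro ω₂ lam β γ hω hl hβ hγ hU μ hμ T hT D hD hpos
  have hF : CruxFrame ω₂ lam β γ μ T D := ⟨hω, hl, hβ, hγ, hU, hμ, hT, hD, hpos⟩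
  have hPlain := hLRp ω₂ lam β γ μ T D hF
  have hDev := hLRd ω₂ lam β γ T hω hl hβ hγ hT
  obtain ⟨C₂, hC₂⟩ := hRO ω₂ lam β γ μ T D hF
  obtain ⟨C₃, hC₃⟩ := hCU ω₂ lam β γ T hω hl hβ hγ hT
  obtain ⟨ρ, hρ0, hρ1, hρ⟩ := hBD ω₂ lam β γ T hω hl hβ hγ hT
  obtain ⟨c₁, hc₁⟩ := hTL ω₂ lam β γ μ T D hF hPlain
  obtain ⟨c₂, hc₂⟩ := hFT ω₂ lam β γ μ T D hF hPlain
  -- uniform constants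
  obtain ⟨c, hc_def⟩ : ∃ c : ℝ, c = max (max c₁ c₂) 0 := ⟨_, rfl⟩
  obtain ⟨K, hK_def⟩ : ∃ K : ℝ, K = γ ^ 2 * Real.sqrt (max C₂ 0 * max C₃ 0) := ⟨_, rfl⟩
  obtain ⟨K', hK'_def⟩ : ∃ K' : ℝ, K' = 2 / (1 - ρ) * K := ⟨_, rfl⟩
  have hc0 : 0 ≤ c := by rw [hc_def]; exact le_max_right _ _
  have hcc₁ : c₁ ≤ c := by rw [hc_def]; exact le_trans (le_max_left _ _) (le_max_left _ _)
  have hcc₂ : c₂ ≤ c := by rw [hc_def]; exact le_trans (le_max_right _ _) (le_max_left _ _)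
  have hK0 : 0 ≤ K := by rw [hK_def]; positivity
  have hρ1' : 0 < 1 - ρ := by linarith
  have hK'0 : 0 ≤ K' := by rw [hK'_def]; positivity
  refine ⟨4 * c + 4 * K' + 4 * K' * (1 + c) + 2, ?_⟩
  intro N M hN hM
  -- the response field of the whole chain and the device data of this split
  obtain ⟨h, hPF⟩ := hPlain (N + M) (by omega)
  obtain ⟨g, gb₁, gb₄, hDF⟩ := hDev N M hN hM
  have hcast : ((N + M : ℕ) : ℝ) - 1 = (N : ℝ) + (M : ℝ) - 1 := by push_cast; ring
  rw [hcast] at hPF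
  -- conductances of the whole and of the pieces
  obtain ⟨gL, hgL⟩ : ∃ gL : ℝ, gL = D (N + M) / ((N : ℝ) + (M : ℝ) - 1) := ⟨_, rfl⟩
  obtain ⟨gN, hgN⟩ : ∃ gN : ℝ, gN = D N / ((N : ℝ) - 1) := ⟨_, rfl⟩
  obtain ⟨gM, hgM⟩ : ∃ gM : ℝ, gM = D M / ((M : ℝ) - 1) := ⟨_, rfl⟩
  have hN' : (2 : ℝ) ≤ (N : ℝ) := by exact_mod_cast hN
  have hM' : (2 : ℝ) ≤ (M : ℝ) := by exact_mod_cast hM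
  have hgN0 : 0 < gN := by rw [hgN]; exact div_pos (hpos N hN) (by linarith)
  have hgM0 : 0 < gM := by rw [hgM]; exact div_pos (hpos M hM) (by linarith)
  have hgL0 : 0 < gL := by rw [hgL]; exact div_pos (hpos (N + M) (by omega)) (by linarith)
  -- the roughness bet picks the Gibbs shift θ₀
  obtain ⟨θ₀, hrough⟩ := hC₂ N M hN hM h hPF
  rw [← hgL] at hPF hrough
  have hsym : ∀ a b, g a b = g b a := hDF.1
  have hpsd : ∀ θ, 0 ≤ dirichletForm g θ := hDF.2.1
  have ha0 : 0 ≤ selfLeft g := selfLeft_nonneg hsym hpsd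
  have hb0 : 0 ≤ selfRight g := selfRight_nonneg hsym hpsd
  -- α-LEG: the identity at θ₀, from both ends, with the two size bets, then the two-ended elimination
  obtain ⟨h1, h4⟩ := hID ω₂ lam β γ T hω hl hβ hγ hT N M hN hM h gL g gb₁ gb₄ hPF hDF θ₀
  obtain ⟨hcurv₁, hcurv₄⟩ := hC₃ N M hN hM g gb₁ gb₄ hDF
  have hro0 : 0 ≤ roughness (pinnedChain ω₂ lam β γ) T N M (fun x => h x - θ₀ * eK T N M x) :=
    integral_nonneg fun _ => sq_nonneg _
  have hα₁ : |sideOne g θ₀ - gL| ≤ K * selfLeft g * gL := by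
    rw [hK_def]; exact insertion_bound_abs ha0 hgL0.le hro0 h1 hcurv₁ hrough
  have hα₄ : |sideFour g θ₀ - gL| ≤ K * selfRight g * gL := by
    rw [hK_def]; exact insertion_bound_abs hb0 hgL0.le hro0 h4 hcurv₄ hrough
  obtain ⟨hu0, hv0, hdom⟩ := hρ N M hN hM g gb₁ gb₄ hDF
  have hα : gL - deviceConductance g ≤ K' * min (selfLeft g) (selfRight g) * gL := by
    rw [hK'_def]
    exact alpha_leg_twoEnded_signs hgL0.le hK0 hρ0 hρ1 hu0 hv0 hdom hα₁ hα₄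
  -- β-LEG: the Dirichlet principle and the one-sided termination/transmission bets
  have hDir := deviceConductance_le hsym hpsd
  obtain ⟨hTLa, hTLb⟩ := hc₁ N M hN hM g gb₁ gb₄ hDF
  have hxup := hc₂ N M hN hM g gb₁ gb₄ hDF
  rw [← hgN] at hTLa hxup
  rw [← hgM] at hTLb hxup
  have ha : selfLeft g ≤ gN * (1 + c * gN) :=
    hTLa.trans (mul_le_mul_of_nonneg_left
      ((add_le_add_iff_left 1).mpr (mul_le_mul_of_nonneg_right hcc₁ hgN0.le)) hgN0.le)
  have hb : selfRight g ≤ gM * (1 + c * gM) :=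
    hTLb.trans (mul_le_mul_of_nonneg_left
      ((add_le_add_iff_left 1).mpr (mul_le_mul_of_nonneg_right hcc₁ hgM0.le)) hgM0.le)
  have hx : bypass g ≤ c * gN * gM :=
    hxup.trans (mul_le_mul_of_nonneg_right (mul_le_mul_of_nonneg_right hcc₂ hgN0.le) hgM0.le)
  -- the real-analysis core
  have key := FarTransmission.core_estimate_unsigned' hgN0 hgM0 hgL0 hK'0 hc0 ha hb hx hα hDir
  rw [hgN, hgM, hgL, one_div_div, one_div_div, one_div_div] at key
  exact key


end TransferV4Signs

end Summit.AtomisticToContinuum.FouriersLaw.Cruxes.SuperadditiveResistance.ThermaliseThenCutProbeInsertion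

end
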